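import Literature.Claims.NS.Durmagambetov2015
import Literature.Analysis.FluidPDE.NSVorticityBKMLocalExistence
import Summits.NavierStokesRegularity.NavierStokesRegularity.Theorems.SoloSalvageRuzmaikina2008
import HarnessLib

/-!
# Solo salvage for claim C30 `Durmagambetov2015` (cell `ns-claims`, D-0090): the local existence
# step (Step 1, Theorem 5 p.93) is TRUE in the rendered class — kernel discharge

Claim skeleton: `Literature/Claims/NS/Durmagambetov2015.lean` (typist `ns-claims-typist-3` g2;
A. A. Durmagambetov, L. S. Fazilova, Natural Science 7 (2015) 88–99). Kill of record (refuter-2):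
`…Theorems.Durmagambetov2015.not_Step8_reconstruction33` (Lemma 17 (33) pp.92–93). This file (seat
`ns-claims-salvage-p3`) kernel-discharges the TRUE classical step at the head of the proof of
Theorem 6:

* `durmagambetov2015_step1_holds : Step1_localExistence` — Theorem 5 p.93 ([17] = Ladyzhenskaya):
  for `ν > 0` and every datum of the rendered class `IsDatum30` (smooth, divergence free, every
  derivative in `L²(ℝ³)`, rapidly decaying) there is `T₁ > 0` and a solution on `[0,T₁]` in the
  rendered class `Ruzmaikina2008.IsSolution` (classical, all `L²` Sobolev norms bounded, `u(0) = q₀`).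
  Mathematics = local existence of `H^m` solutions, Majda–Bertozzi 2002 Thm 3.4 (Kato 1972), in the
  tree as the PROVED named fact `MajdaBertozzi2002_localExistenceH3_holds`
  (`NSVorticityBKMLocalExistence.lean`); the work here is only the instantiation (the `H³`-size
  parameter `A` is the datum's own `∑_{n<4} ‖Dⁿq₀‖₂²`, finite in the class).

* (rev 2) `durmagambetov2015_clayDelta30_holds : ClayDelta30` — the horizon-patching delta of the Clay
  link (Δ6: unique solutions on the nested `[0,T]` define ONE global solution in the class) is TRUE: it is
  C25's `ClayDelta` on the smaller data class `IsDatum30 ⊆ IsDatum`, and `ClayDelta` is a theorem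
  (`…Ruzmaikina2008Salvage.ruzmaikina2008_clayDelta_holds`, `SoloSalvageRuzmaikina2008.lean` rev 2). Hence the
  skeleton's `clayA_of_claimed_of_delta durmagambetov2015_clayDelta30_holds : ClaimedTheoremT →
  clayR3.Regularity` is unconditional: C30 has no residual delta against Clay (A) in the kernel.

Solo lane (`Theorems/SoloSalvage<Slug>.lean`, no item).

WHAT THIS IS NOT: not a claim about NS regularity or blow-up; not a claim about any author beyond the
typed locator.
-/

noncomputable section

-- The summit-side namespace repeats the summit name by design (D-0017 layout); tree precedent
-- `SoloSalvageLam2019.lean`.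
set_option linter.dupNamespace false

open MeasureTheory Set
open scoped ENNReal NNReal ContDiff

namespace Summit.NavierStokesRegularity.NavierStokesRegularity.Theorems.Durmagambetov2015Salvage

open Literature.Analysis.FluidPDE Literature.Claims.NS.Ruzmaikina2008 Literature.Claims.NS.Durmagambetov2015

/-- **Step 1 — Theorem 5 p.93 (local existence and uniqueness, [17]) holds in the rendered class**:
for `ν > 0` and `q₀ ∈ IsDatum30` there are `T₁ > 0` and a solution `(u, p)` on `[0, T₁]` in the class
with `u(0) = q₀` (Majda–Bertozzi 2002 Thm 3.4 via the tree's `MajdaBertozzi2002_localExistenceH3_holds`,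
instantiated at the datum's `H³` size). -/
theorem durmagambetov2015_step1_holds : Literature.Claims.NS.Durmagambetov2015.Step1_localExistence := by
  intro ν hν q₀ hq₀
  obtain ⟨⟨hsmooth, hdiv, hsob⟩, -⟩ := hq₀
  -- the `H³` size of the datum, finite in the class
  set Atot : ℝ≥0∞ := ∑ n ∈ Finset.range 4, ∫⁻ x, ‖iteratedFDeriv ℝ n q₀ x‖ₑ ^ 2 with hA
  have hAtop : Atot ≠ ⊤ := by
    rw [hA]
    exact (ENNReal.sum_lt_top.2 fun n _ => hsob n).ne
  obtain ⟨τ, hτ, hloc⟩ := MajdaBertozzi2002_localExistenceH3_holds hν.le Atot.toNNReal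
  obtain ⟨v, q, hv, hv0, hB⟩ := hloc hsmooth hdiv hsob (by rw [ENNReal.coe_toNNReal hAtop])
  exact ⟨τ, hτ, v, q, ⟨⟨hv, hB⟩, hv0⟩⟩

/-! ### rev 2: the horizon-patching delta `ClayDelta30` is a theorem -/

/-- **`ClayDelta30` holds**: C25's patching statement `Ruzmaikina2008.ClayDelta` (a theorem,
`ruzmaikina2008_clayDelta_holds`) restricted to the data class `IsDatum30` (= `IsDatum` ∧ rapid decay). -/
theorem durmagambetov2015_clayDelta30_holds : Literature.Claims.NS.Durmagambetov2015.ClayDelta30 :=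
  fun ν hν u₀ hu₀ => Ruzmaikina2008Salvage.ruzmaikina2008_clayDelta_holds ν hν u₀ hu₀.1

/-- The Clay (A) link of C30 without any delta hypothesis: the T-dependent reading of Theorem 6 implies
Fefferman's (A) outright (skeleton `clayA_of_claimed_of_delta` fed with `durmagambetov2015_clayDelta30_holds`). -/
theorem clayA_of_claimedT (h : Literature.Claims.NS.Durmagambetov2015.ClaimedTheoremT) :
    Literature.Claims.NS.ClayVariants.clayR3.Regularity :=
  clayA_of_claimed_of_delta durmagambetov2015_clayDelta30_holds h

end Summit.NavierStokesRegularity.NavierStokesRegularity.Theorems.Durmagambetov2015Salvage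

end
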